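import Literature.NumberTheory.Rogawski1990.UnitFundamentalLemmaInertFlickerRepresentatives   -- ★ p841570 (ψ, level clause) / p840795 (e)
import Literature.NumberTheory.Automorphic.ValuedFieldValuativeRelBridge                        -- ★ `mem_glInt_iff_forall_v_le_one`
import Literature.NumberTheory.Automorphic.HyperspecialUnitaryCartanUnique                      -- ★ `unitaryInt`, `mem_unitaryInt_iff`
import HarnessLib

/-!
# Transport of fixed cosets along a group isomorphism carrying `K` onto `K′`: `#Fix_{G∕K}(γ) = #Fix_{G′∕K′}(φ γ)`, and the CM instance along the frame
# `e : G′_v ≃ₜ* U(σ_w, Φ₃)(L_w)` (Rogawski 1990 §14.2 «K_v ≃ K′_v»; Flicker 1998 §3 Prop. 5)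

Topic `NumberTheory/Automorphic`; namespace `Literature.NumberTheory.Automorphic`.  **Theorems only** (no `def`, no instance, no notation, no named fact, no
`sorry`); imports = tree.  Brick (c) «TRANSPORT OF THE G-SIDE VALUES» of the road «N7-ns COUNT FROM FLICKER» (LEAD F0P3a-plan T8-71; F0P3-p02 (g11)):
the values of the count junction are FIXED-POINT COUNTS — `Φ(⟦γ′⟧, 1_{K′}) = #{q ∈ G′_v ∕ K′ : γ′ q = q}` by ★ (L2)
`orbitalIntegral_indicator_quotientMeasure_eq_natCard_fixedPoints`, and Flicker's unfolding (★ `natCard_fixedPoints_unitaryInt_eq_finsum_flickerU`, Prop. 5) counts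
`#{q ∈ U ∕ K : t q = q}` in HIS model `U = U(σ_w, Φ₃)(L_w)`, `K = unitaryInt` — so the transport between the two models is GROUP THEORY, measure-free.

* §1 (any groups) `φ : G ≃* G′` with `g ∈ K ↔ φ g ∈ K′`: `exists_quotient_equiv_forall_mk` (`G ⧸ K ≃ G′ ⧸ K′`, `gK ↦ φ(g)K′`, Mathlib `Quotient.congr` on
  `leftRel`), **`nonempty_fixedCosets_equiv`** (`{q : γ • q = q} ≃ {q′ : φ γ • q′ = q′}`, by `G`-equivariance), **`natCard_fixedCosets_eq`**, `finite_fixedCosets_iff`.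
* §2 (CM) for ANY frame `e : G′_v = ↥(UnitaryGroup.«local» L c 3 H′ v) ≃ₜ* ↥(unitaryGroupOfForm σ_w (placeForm Φ₃ w))` with the level clause of ★
  `exists_frame_of_nonsplit` (`g ∈ K′ ↔ (e g).val ∈ glInt`; `unitaryInt` = ★ `glInt` by ★ `mem_glInt_iff_forall_v_le_one` ∕ `mem_unitaryInt_iff`):
  **`natCard_fixedCosets_cmLocalIntegralLevel_eq_of_frame`** and `finite_fixedCosets_cmLocalIntegralLevel_iff_of_frame` — with ★
  `exists_four_matched_flicker_representatives` (`ψ`-images = Flicker's literals, `e = localNonsplitEquiv_{Φ₃} ∘ ψ`) the count junction reads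
  `X_i = #Fix(e t_i)` at the literal `t_1, t_π, t₃, t₄`.

## References
* J. Rogawski, *Automorphic Representations of Unitary Groups in Three Variables*, Ann. of Math. Stud. 123 (1990), §14.2 p. 233 [Rogawski1990].
* Y. Z. Flicker, *Elementary proof of the fundamental lemma for a unitary group*, Canad. J. Math. 50 (1998), §3 p. 80, Prop. 5 p. 82 [Flicker1998UnitaryFL].
-/

set_option autoImplicit false

noncomputable section

open NumberField IsDedekindDomain Matrix
open scoped MatrixGroups Pointwise

namespace Literature.NumberTheory.Automorphic

/-! ## §1 Generic: fixed cosets under a group isomorphism -/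

section Generic

variable {G G' : Type*} [Group G] [Group G'] (φ : G ≃* G') {K : Subgroup G} {K' : Subgroup G'}

/-- **The induced bijection of coset spaces** `G ⧸ K ≃ G′ ⧸ K′`, `g K ↦ φ(g) K′`, for a group isomorphism `φ` with `g ∈ K ↔ φ g ∈ K′`.
[cite: Rogawski1990, §14.2 p. 233] -/
theorem exists_quotient_equiv_forall_mk (hK : ∀ g, g ∈ K ↔ φ g ∈ K') :
    ∃ E : G ⧸ K ≃ G' ⧸ K', ∀ g : G, E (QuotientGroup.mk g) = QuotientGroup.mk (φ g) := by
  refine ⟨Quotient.congr φ.toEquiv fun a b => ?_, fun g => rfl⟩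
  rw [QuotientGroup.leftRel_apply, QuotientGroup.leftRel_apply, hK (a⁻¹ * b), map_mul, map_inv]
  rfl

/-- **FIXED COSETS CORRESPOND**: `{q ∈ G ⧸ K : γ q = q} ≃ {q′ ∈ G′ ⧸ K′ : φ(γ) q′ = q′}` along `g K ↦ φ(g) K′` (the bijection is `G`-equivariant:
`E(γ · gK) = φ(γ) · E(gK)`).  This is how the unit orbital integral `∫ 1_K(x⁻¹γx) = #Fix_{G∕K}(γ)` is read in any isomorphic model `(G′, K′)` of `(G, K)`.
[cite: Rogawski1990, §14.2 p. 233] [cite: Flicker1998UnitaryFL, §3 p. 80] -/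
theorem nonempty_fixedCosets_equiv (hK : ∀ g, g ∈ K ↔ φ g ∈ K') (γ : G) :
    Nonempty ({q : G ⧸ K | γ • q = q} ≃ {q : G' ⧸ K' | φ γ • q = q}) := by
  obtain ⟨E, hE⟩ := exists_quotient_equiv_forall_mk φ hK
  have hEq : ∀ q : G ⧸ K, E (γ • q) = φ γ • E q := by
    intro q
    induction q using QuotientGroup.induction_on with
    | H g => rw [MulAction.Quotient.smul_mk, hE, hE, MulAction.Quotient.smul_mk, smul_eq_mul, smul_eq_mul, map_mul]
  refine ⟨E.subtypeEquiv fun q => ?_⟩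
  simp only [Set.mem_setOf_eq]
  rw [← hEq]
  exact E.apply_eq_iff_eq.symm

/-- **`#Fix_{G∕K}(γ) = #Fix_{G′∕K′}(φ γ)`.** [cite: Rogawski1990, §14.2 p. 233] [cite: Flicker1998UnitaryFL, §3 p. 80] -/
theorem natCard_fixedCosets_eq (hK : ∀ g, g ∈ K ↔ φ g ∈ K') (γ : G) :
    Nat.card {q : G ⧸ K | γ • q = q} = Nat.card {q : G' ⧸ K' | φ γ • q = q} :=
  Nat.card_congr (nonempty_fixedCosets_equiv φ hK γ).some

/-- Finiteness of the fixed cosets transports. [cite: Rogawski1990, §14.2 p. 233] -/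
theorem finite_fixedCosets_iff (hK : ∀ g, g ∈ K ↔ φ g ∈ K') (γ : G) :
    {q : G ⧸ K | γ • q = q}.Finite ↔ {q : G' ⧸ K' | φ γ • q = q}.Finite := by
  obtain ⟨E⟩ := nonempty_fixedCosets_equiv φ hK γ
  rw [← Set.finite_coe_iff, ← Set.finite_coe_iff]
  exact ⟨fun h => Finite.of_equiv _ E, fun h => Finite.of_equiv _ E.symm⟩

end Generic

/-! ## §2 The two CM instances: the frame `e : G′_v ≃ U(σ_w, Φ₃)(L_w)` and the congruence `ψ : G′_v ≃ U(Φ₃)(L⁺_v)` -/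

section CM

open Literature.NumberTheory.Automorphic.UnitaryGroup
open Literature.NumberTheory.Automorphic.HermitianLattice (unitaryInt mem_unitaryInt_iff)

variable (L : Type) [Field L] [NumberField L] [IsCMField L] (H' : Matrix (Fin 3) (Fin 3) L)
  {v : HeightOneSpectrum (𝓞 ↥(maximalRealSubfield L))}

set_option synthInstance.maxHeartbeats 200000 in
-- the coset action of the heavy one-place ∕ `LocalRing` unitary-group carriers is found past the default synthesis budget (as in ★ `UnitOrbitalIntegralUnfoldingHK`)
/-- **`#Fix_{G′_v ∕ K′}(γ′) = #Fix_{U(σ_w,Φ₃)(L_w) ∕ U(Φ₃)(𝒪_w)}(e γ′)`** for any frame `e : G′_v ≃ₜ* U(σ_w, Φ₃)(L_w)` carrying `K′ = U(H′)(𝒪_v)` onto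
`GL₃(𝒪_w) ∩ U` (the level clause of ★ `exists_frame_of_nonsplit`; `unitaryInt` = entries of `g, g⁻¹` in `𝒪_w` = ★ `glInt`, ★ `mem_glInt_iff_forall_v_le_one`) —
the `G`-side values `Φ(⟦γ′⟧, 1_{K′}) = #Fix` (★ `orbitalIntegral_indicator_quotientMeasure_eq_natCard_fixedPoints`) are Flicker's counts in his model
(★ `natCard_fixedPoints_unitaryInt_eq_finsum_flickerU`). [cite: Rogawski1990, §14.2 p. 233] [cite: Flicker1998UnitaryFL, §3 Prop. 5 p. 82] -/
theorem natCard_fixedCosets_cmLocalIntegralLevel_eq_of_frame (w : UnitaryGroup.PlacesOver L v) (hw : IsCMField.complexConj L • w.1 = w.1)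
    (e : ↥(UnitaryGroup.«local» L (IsCMField.complexConj L) 3 H' v) ≃ₜ*
      ↥(unitaryGroupOfForm (galAdicCompletionMap (L := L) (IsCMField.complexConj L) hw)
        (placeForm (Matrix.of fun i j : Fin 3 => if i.val + j.val + 1 = 3 then (1 : L) else 0) w.1)))
    (hlev : ∀ g, g ∈ cmLocalIntegralLevel L 3 H' v ↔ ((e g).val : GL (Fin 3) (w.1.adicCompletion L)) ∈ glInt 3 (w.1.adicCompletion L))
    (t : (cmDatum L 3 H').Local v) :
    Nat.card {q : (cmDatum L 3 H').Local v ⧸ cmLocalIntegralLevel L 3 H' v | t • q = q} =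
      Nat.card {q : ↥(unitaryGroupOfForm (galAdicCompletionMap (L := L) (IsCMField.complexConj L) hw)
          (placeForm (Matrix.of fun i j : Fin 3 => if i.val + j.val + 1 = 3 then (1 : L) else 0) w.1)) ⧸
        unitaryInt (galAdicCompletionMap (L := L) (IsCMField.complexConj L) hw)
          (placeForm (Matrix.of fun i j : Fin 3 => if i.val + j.val + 1 = 3 then (1 : L) else 0) w.1) | e t • q = q} := by
  refine natCard_fixedCosets_eq e.toMulEquiv (fun g => (hlev g).trans ?_) t
  rw [mem_glInt_iff_forall_v_le_one]
  exact mem_unitaryInt_iff.symm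

set_option synthInstance.maxHeartbeats 200000 in
-- the coset action of the heavy one-place ∕ `LocalRing` unitary-group carriers is found past the default synthesis budget (as in ★ `UnitOrbitalIntegralUnfoldingHK`)
/-- Finiteness of the fixed cosets transports along the frame (input `hfin` of ★ `natCard_fixedPoints_unitaryInt_eq_finsum_flickerU` from the
`G′_v`-side finiteness ★ `finite_fixedPoints…`, or conversely). [cite: Rogawski1990, §14.2 p. 233] -/
theorem finite_fixedCosets_cmLocalIntegralLevel_iff_of_frame (w : UnitaryGroup.PlacesOver L v) (hw : IsCMField.complexConj L • w.1 = w.1)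
    (e : ↥(UnitaryGroup.«local» L (IsCMField.complexConj L) 3 H' v) ≃ₜ*
      ↥(unitaryGroupOfForm (galAdicCompletionMap (L := L) (IsCMField.complexConj L) hw)
        (placeForm (Matrix.of fun i j : Fin 3 => if i.val + j.val + 1 = 3 then (1 : L) else 0) w.1)))
    (hlev : ∀ g, g ∈ cmLocalIntegralLevel L 3 H' v ↔ ((e g).val : GL (Fin 3) (w.1.adicCompletion L)) ∈ glInt 3 (w.1.adicCompletion L))
    (t : (cmDatum L 3 H').Local v) :
    {q : (cmDatum L 3 H').Local v ⧸ cmLocalIntegralLevel L 3 H' v | t • q = q}.Finite ↔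
      {q : ↥(unitaryGroupOfForm (galAdicCompletionMap (L := L) (IsCMField.complexConj L) hw)
          (placeForm (Matrix.of fun i j : Fin 3 => if i.val + j.val + 1 = 3 then (1 : L) else 0) w.1)) ⧸
        unitaryInt (galAdicCompletionMap (L := L) (IsCMField.complexConj L) hw)
          (placeForm (Matrix.of fun i j : Fin 3 => if i.val + j.val + 1 = 3 then (1 : L) else 0) w.1) | e t • q = q}.Finite := by
  refine finite_fixedCosets_iff e.toMulEquiv (fun g => (hlev g).trans ?_) t
  rw [mem_glInt_iff_forall_v_le_one]
  exact mem_unitaryInt_iff.symm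

set_option synthInstance.maxHeartbeats 200000 in
-- as above
/-- The same in the `MulAction.fixedBy` spelling of ★ `classOrbitalIntegral_indicator_complex_cmLocalIntegralLevel_eq_natCard_fixedBy` (the `G′_v`-socket
`Φ(⟦γ′⟧, 1_{K′}) = #Fix_{γ′}`): `Nat.card (fixedBy (G′_v ⧸ K′) γ′) = #{q ∈ U_w ∕ unitaryInt : e γ′ • q = q}`. [cite: Rogawski1990, §14.2 p. 233; §4.9 Prop. 4.9.1 (b) p. 55]
[cite: Flicker1998UnitaryFL, §3 Prop. 5 p. 82] -/
theorem natCard_fixedBy_cmLocalIntegralLevel_eq_of_frame (w : UnitaryGroup.PlacesOver L v) (hw : IsCMField.complexConj L • w.1 = w.1)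
    (e : ↥(UnitaryGroup.«local» L (IsCMField.complexConj L) 3 H' v) ≃ₜ*
      ↥(unitaryGroupOfForm (galAdicCompletionMap (L := L) (IsCMField.complexConj L) hw)
        (placeForm (Matrix.of fun i j : Fin 3 => if i.val + j.val + 1 = 3 then (1 : L) else 0) w.1)))
    (hlev : ∀ g, g ∈ cmLocalIntegralLevel L 3 H' v ↔ ((e g).val : GL (Fin 3) (w.1.adicCompletion L)) ∈ glInt 3 (w.1.adicCompletion L))
    (t : (cmDatum L 3 H').Local v) :
    Nat.card (MulAction.fixedBy ((cmDatum L 3 H').Local v ⧸ cmLocalIntegralLevel L 3 H' v) t) =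
      Nat.card {q : ↥(unitaryGroupOfForm (galAdicCompletionMap (L := L) (IsCMField.complexConj L) hw)
          (placeForm (Matrix.of fun i j : Fin 3 => if i.val + j.val + 1 = 3 then (1 : L) else 0) w.1)) ⧸
        unitaryInt (galAdicCompletionMap (L := L) (IsCMField.complexConj L) hw)
          (placeForm (Matrix.of fun i j : Fin 3 => if i.val + j.val + 1 = 3 then (1 : L) else 0) w.1) | e t • q = q} :=
  natCard_fixedCosets_cmLocalIntegralLevel_eq_of_frame L H' w hw e hlev t

end CM

/-! ## §3 (appended) Along the congruence `ψ` of ★ `exists_four_matched_flicker_representatives`: the frame `e := localNonsplitEquiv_{Φ₃} ∘ ψ` -/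

section Congr

open Literature.NumberTheory.Automorphic.UnitaryGroup
open Literature.NumberTheory.Automorphic.HermitianLattice (unitaryInt mem_unitaryInt_iff)

variable (L : Type) [Field L] [NumberField L] [IsCMField L] (H' : Matrix (Fin 3) (Fin 3) L)
  {v : HeightOneSpectrum (𝓞 ↥(maximalRealSubfield L))}

set_option synthInstance.maxHeartbeats 200000 in
-- the coset action of the one-place unitary carrier (as in §2)
/-- **`#Fix_{G′_v ∕ K′}(γ′) = #Fix_{U_w ∕ unitaryInt}((ψ γ′)_w)`** for the level-preserving congruence `ψ : G′_v ≃ₜ* U(Φ₃)(L⁺_v)` of ★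
`exists_four_matched_flicker_representatives` ∕ ★ `exists_localRing_congr` (`g ∈ K′ ↔ ψ g ∈ K_Φ`), composed with the one-place model ★ `localNonsplitEquiv`
(`K_Φ ↔ GL₃(𝒪_w)`, ★ `mem_localIntegralLevel_iff_of_smul_eq`): the frame is `e := localNonsplitEquiv_{Φ₃} ∘ ψ`, and `(e γ′)` has matrix
`(ψ γ′).val.val` read at `w` (★ `coe_coe_localNonsplitEquiv_apply`, `rfl`) — so when `ψ tᵢ` IS Flicker's literal over `E_v`, `e tᵢ` is the literal over `L_w`.
[cite: Rogawski1990, §14.2 p. 233; §4.9 Prop. 4.9.1 (b) p. 55] [cite: Flicker1998UnitaryFL, §3 Prop. 5 p. 82] -/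
theorem natCard_fixedBy_cmLocalIntegralLevel_eq_of_congr (w : UnitaryGroup.PlacesOver L v) (hw : IsCMField.complexConj L • w.1 = w.1)
    (ψ : ↥(UnitaryGroup.«local» L (IsCMField.complexConj L) 3 H' v) ≃ₜ*
      ↥(UnitaryGroup.«local» L (IsCMField.complexConj L) 3 (Matrix.of fun i j : Fin 3 => if i.val + j.val + 1 = 3 then (1 : L) else 0) v))
    (hlev : ∀ g, g ∈ cmLocalIntegralLevel L 3 H' v ↔
      ψ g ∈ cmLocalIntegralLevel L 3 (Matrix.of fun i j : Fin 3 => if i.val + j.val + 1 = 3 then (1 : L) else 0) v)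
    (t : (cmDatum L 3 H').Local v) :
    Nat.card (MulAction.fixedBy ((cmDatum L 3 H').Local v ⧸ cmLocalIntegralLevel L 3 H' v) t) =
      Nat.card {q : ↥(unitaryGroupOfForm (galAdicCompletionMap (L := L) (IsCMField.complexConj L) hw)
          (placeForm (Matrix.of fun i j : Fin 3 => if i.val + j.val + 1 = 3 then (1 : L) else 0) w.1)) ⧸
        unitaryInt (galAdicCompletionMap (L := L) (IsCMField.complexConj L) hw)
          (placeForm (Matrix.of fun i j : Fin 3 => if i.val + j.val + 1 = 3 then (1 : L) else 0) w.1) |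
        localNonsplitEquiv (IsCMField.complexConj L) (Matrix.of fun i j : Fin 3 => if i.val + j.val + 1 = 3 then (1 : L) else 0)
          (IsCMField.complexConj_ne_one L) w hw (ψ t) • q = q} := by
  have hc := IsCMField.complexConj_ne_one L
  have h := natCard_fixedBy_cmLocalIntegralLevel_eq_of_frame L H' w hw
    (ψ.trans (localNonsplitEquiv (IsCMField.complexConj L) (Matrix.of fun i j : Fin 3 => if i.val + j.val + 1 = 3 then (1 : L) else 0) hc w hw))
    (fun g => (hlev g).trans (mem_localIntegralLevel_iff_of_smul_eq (IsCMField.complexConj L) 3 _ hc w hw (ψ g))) t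
  rw [h, ContinuousMulEquiv.trans_apply]

set_option synthInstance.maxHeartbeats 200000 in
-- as above
/-- Finiteness of the fixed cosets along the composite frame `e := localNonsplitEquiv_{Φ₃} ∘ ψ` (the `hfin` input of ★ `natCard_fixedPoints_unitaryInt_eq_finsum_flickerU`
from the `G′_v`-side finiteness at an elliptic regular class, or conversely). [cite: Rogawski1990, §14.2 p. 233] [cite: Flicker1998UnitaryFL, §3 Prop. 5 p. 82] -/
theorem finite_fixedBy_cmLocalIntegralLevel_iff_of_congr (w : UnitaryGroup.PlacesOver L v) (hw : IsCMField.complexConj L • w.1 = w.1)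
    (ψ : ↥(UnitaryGroup.«local» L (IsCMField.complexConj L) 3 H' v) ≃ₜ*
      ↥(UnitaryGroup.«local» L (IsCMField.complexConj L) 3 (Matrix.of fun i j : Fin 3 => if i.val + j.val + 1 = 3 then (1 : L) else 0) v))
    (hlev : ∀ g, g ∈ cmLocalIntegralLevel L 3 H' v ↔
      ψ g ∈ cmLocalIntegralLevel L 3 (Matrix.of fun i j : Fin 3 => if i.val + j.val + 1 = 3 then (1 : L) else 0) v)
    (t : (cmDatum L 3 H').Local v) :
    (MulAction.fixedBy ((cmDatum L 3 H').Local v ⧸ cmLocalIntegralLevel L 3 H' v) t).Finite ↔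
      {q : ↥(unitaryGroupOfForm (galAdicCompletionMap (L := L) (IsCMField.complexConj L) hw)
          (placeForm (Matrix.of fun i j : Fin 3 => if i.val + j.val + 1 = 3 then (1 : L) else 0) w.1)) ⧸
        unitaryInt (galAdicCompletionMap (L := L) (IsCMField.complexConj L) hw)
          (placeForm (Matrix.of fun i j : Fin 3 => if i.val + j.val + 1 = 3 then (1 : L) else 0) w.1) |
        localNonsplitEquiv (IsCMField.complexConj L) (Matrix.of fun i j : Fin 3 => if i.val + j.val + 1 = 3 then (1 : L) else 0)
          (IsCMField.complexConj_ne_one L) w hw (ψ t) • q = q}.Finite := by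
  have hc := IsCMField.complexConj_ne_one L
  have h := finite_fixedCosets_cmLocalIntegralLevel_iff_of_frame L H' w hw
    (ψ.trans (localNonsplitEquiv (IsCMField.complexConj L) (Matrix.of fun i j : Fin 3 => if i.val + j.val + 1 = 3 then (1 : L) else 0) hc w hw))
    (fun g => (hlev g).trans (mem_localIntegralLevel_iff_of_smul_eq (IsCMField.complexConj L) 3 _ hc w hw (ψ g))) t
  rw [ContinuousMulEquiv.trans_apply] at h
  exact h

end Congr

end Literature.NumberTheory.Automorphic
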